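/-
Copyright: statement-level skeleton of a published paper (lit-balaban cell, Phase-2 proof seat p25, gen 18). No proof
claims beyond what the kernel checks below.
-/
import Literature.MathematicalPhysics.QuantumFieldTheory.BalabanImbrieJaffe1984to88.BIJ88WalkResummation312
import Literature.MathematicalPhysics.QuantumFieldTheory.BalabanImbrieJaffe1984to88.BIJ88LabelledRemainderFieldLaw312

/-!
# `BalabanImbrieJaffe1984to88.BIJ88WalkRemainderFieldLaw312` — T. Bałaban, J. Imbrie, A. Jaffe, *Effective action and
cluster properties of the abelian Higgs model*, Commun. Math. Phys. **114** (1988) 257–315 [BalabanImbrieJaffe1988],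
§5.14 p. 311–312 [PDF 55–56], verbatim: *"Summing all terms in X_r gives an observable F_{k,rem}(X_r)."* (p. 312),
*"The components containing contractions to χ′_{Λ₁₂^{(k)}}, terms from the random walk expansions, or at least m̄+1
interactions are called remainder components {X_r}."* (p. 311 [PDF 55], `p0055.txt` L36–37), *"By performing
sufficiently many integrations by parts, we have arranged for enough small factors to beat these large factors in the
remainder terms (at least if X_{r′} is not at the boundary of Λ₁₂^{(k)})."* (p. 312) — **THE REMAINDER PART OF THE COVARIANCE-SPLIT
EXPANSION ON THE LAW OF THE FIELDS** (p25 gen 18; the covariance-split form of p25 gen 17's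
`BIJ88LabelledRemainderFieldLaw312`): on the §5.13 model of record (`prec`, `src`, `fieldLaw`), the remainder part
`remv` of `BIJ88WalkResummation312` is `Z` times a sum of normalized expectations, one per remainder term
(`remv_div_eq_sum_fieldLaw`), and every term with a `χ′`-contraction carries the small shell probability
`√ℙ_W(Sh)` (`abs_remTerm_le_shell`, Cauchy–Schwarz on the law, from gen 17's `abs_integral_fieldLaw_le_shell`).

statement-level skeleton of published theorems with citation tags; proofs where landed; nothing here is a claim
about the Yang–Mills mass gap

PDF held: `paper:balaban1988-cmp114-bij-abelian-higgs-effective-action` (journal page = PDF page + 256); p. 312 =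
PDF 56 (`p0056.txt` L1–25 re-read 2026-08-22); v1.1 docfix D-g65-1 (ref-5 g65, p25 gen 19): the second quotation is printed on
p. 311 = PDF 55 (`p0055.txt` L36–37), page locators corrected here and on `abs_remTerm_le_shell`; quotations aligned
with the x2 renders `lit-balaban-r16/renders/cmp114/original-p055-x2.png` / `…-p056-x2.png`; declarations untouched.

CITATION HEADER (lean-in-tree rule).  lit-balaban cell (HOME `run/shared/lean/pub/lit-balaban/`), Phase 2, seat p25
gen 18; row **C2.Claim@312** of `HOME/lit-balaban-r16/ROWS-C2-part2.md` (owner r16, referee ref-5; head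
`BIJ88Sect5StatementsPart4.Ineq312` untouched — MEMBER of the row).  USED BY NAME, nothing restated:
`BIJ88WalkResummation312.remv`, `BIJ88WalkIdentity311.tval`, `BIJ88WalkExpansion311.expand` (this seat and
generation), `BIJ88LabelledRemainderFieldLaw312.{gintM_eq_mul_integral_fieldLaw, abs_integral_fieldLaw_le_shell}`
(p25 gen 17), `BIJ88SlotMomentsGauss308.{fieldLaw, integral_density_pos}` (p36), `BIJ88PolymerRep5134Gauss.{prec, src}`.

## What is proved (0 `sorry`, standard axioms, no new `Prop` facts; theorems only)

* **`remv_div_eq_sum_fieldLaw`**: `remv(O)/Z = Σ_{t ∈ expand 0 O, no block} coef_t · 𝔼_W[Π_{legs of t's X_r}Φ·(Π_{dirs t}∂)χ·e^{−V}]`.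
* **`abs_remTerm_le_shell`**: for a term with a `χ′`-contraction (`dirs t ≠ []`),
  `|𝔼_W[Π_{legs}Φ·(Π_{dirs t}∂)χ·e^{−V}]| ≤ √𝔼_W[(ΠΦ)²]·K_{dirs t}·√ℙ_W(Sh)`.
HONEST SCOPE: (a) identities and ONE small factor (the shell probability, for the `χ′` terms); the other two sources
of smallness of a remainder component (≥ M+1 vertices: `c_M^{M+1}`; a walk piece: `θ^{#reg}`) are in the weights
(`BIJ88WalkWeights312`/`ActivityShape312`), and the moments `𝔼_W[(ΠΦ)²]`, `K_D`, `ℙ_W(Sh)` are not estimated here;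
(b) no localization of the remainder components at cube sets yet (the analogue of `BIJ88WalkBlockActivity312.flAt`
for `X_r` is the next generation's); (c) no `Ineq312` binder.  NOT summit progress; NOT continuum; NOT Clay.  Imports
`BIJ88WalkResummation312`, `BIJ88LabelledRemainderFieldLaw312`; modifies nothing.
-/

noncomputable section

namespace Literature.MathematicalPhysics.QuantumFieldTheory.BalabanImbrieJaffe1984to88.BIJ88WalkRemainderFieldLaw312

open Classical MeasureTheory Matrix Finset
open scoped BigOperators ContDiff
open Literature.MathematicalPhysics.QuantumFieldTheory.Balaban1983to89
open B2Eq228Conditioning (weight source)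
open BIJ88PolymerRep5134 (corner)
open BIJ88PolymerRep5134Gauss (prec src)
open BIJ88SlotMomentsGauss308 (fieldLaw integral_fieldLaw integral_density_pos)
open BIJ88VertexIbp311 (lmono vexp)
open BIJ88WickDerivatives305 (dlist)
open BIJ88LabelledExpansion311 (gintM)
open BIJ88LabelledRemainderFieldLaw312 (gintM_eq_mul_integral_fieldLaw abs_integral_fieldLaw_le_shell)
open BIJ88WalkRun311 BIJ88WalkExpansion311 BIJ88WalkIdentity311 BIJ88WalkResummation312

variable {ι : Type} [Fintype ι] {κ : Type} [LinearOrder κ] {P : Type} [Fintype P]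
variable {α I : Type} [Fintype α] [DecidableEq α] [Fintype I] [DecidableEq I]
  {blk : α → I} {Δ : Matrix α α ℝ} {ℱ : α → ℝ} {W : Finset I}

/-- **THE REMAINDER PART ON THE LAW**: with the covariance split `Σ_p Cov p = (prec)⁻¹`,
`remv(O)/Z = Σ_{t ∈ expand 0 O, no block} coef_t · 𝔼_W[Π_{pending legs of t's remainder components}Φ·(Π_{dirs t}∂)χ·e^{−V}]`,
`Z = ∫ weight·source`. [cite: BalabanImbrieJaffe1988, §5.14 p.312] -/
theorem remv_div_eq_sum_fieldLaw (hPD : (prec blk Δ W (corner ℝ W)).PosDef)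
    (Cov : P → Matrix {x : α // blk x ∈ W} {x : α // blk x ∈ W} ℝ) (trig : P → Bool) (c : ι → ℝ)
    (legs : ι → List ({x : α // blk x ∈ W} → ℝ)) (obs : κ → List ({x : α // blk x ∈ W} → ℝ)) (M : ℕ)
    (χ : ({x : α // blk x ∈ W} → ℝ) → ℝ) (O : Finset κ) :
    remv (prec blk Δ W (corner ℝ W)) Cov trig (src blk ℱ W) c legs obs M χ [] 0 O
        / ∫ φ, weight (prec blk Δ W (corner ℝ W)) φ * source (src blk ℱ W) φ
      = (((expand Cov trig (src blk ℱ W) c legs obs M 0 O).filter fun t => t.consts = 0).map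
          fun t => t.coef * ∫ φ, ((t.groups.map fun h => (h.pend : Multiset _)).sum.map fun w => φ ⬝ᵥ w).prod
            * (dlist t.dirs χ φ * vexp c legs φ) ∂(fieldLaw blk Δ ℱ W)).sum := by
  rw [remv, div_eq_mul_inv, ← Multiset.sum_map_mul_right]
  refine congrArg _ (Multiset.map_congr rfl fun t _ => ?_)
  rw [tval, List.nil_append, gintM_eq_mul_integral_fieldLaw blk Δ ℱ W hPD, mul_assoc, mul_comm (∫ φ, weight _ φ * _),
    mul_assoc, mul_inv_cancel₀ (integral_density_pos blk Δ ℱ W hPD).ne', mul_one]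

omit [LinearOrder κ] [Fintype P] in
/-- **A `χ′`-CONTRACTION GIVES THE SMALL SHELL FACTOR** (*"The components containing contractions to χ′_{Λ₁₂^{(k)}},
… are called remainder components"*, p. 311): for a term `t` of the covariance-split expansion with at least one `χ′`-direction, cutoff
`χ ∈ C^∞` with `χ′ = 0` off the closed shell `Sh` and `|(Π_D∂)χ·e^{−V}| ≤ K_D`:
`|𝔼_W[Π_{legs}Φ·(Π_{dirs t}∂)χ·e^{−V}]| ≤ √𝔼_W[(Π_{legs}Φ)²] · K_{dirs t} · √ℙ_W(Sh)`.
[cite: BalabanImbrieJaffe1988, §5.14 p.311–312] -/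
theorem abs_remTerm_le_shell (hPD : (prec blk Δ W (corner ℝ W)).PosDef) (c : ι → ℝ)
    (legs : ι → List ({x : α // blk x ∈ W} → ℝ)) {χ : ({x : α // blk x ∈ W} → ℝ) → ℝ} (hχ : ContDiff ℝ ∞ χ)
    {Kd : List ({x : α // blk x ∈ W} → ℝ) → ℝ} (hK : ∀ D φ, |dlist D χ φ * vexp c legs φ| ≤ Kd D)
    {Sh : Set ({x : α // blk x ∈ W} → ℝ)} (hSh : IsClosed Sh) (hχS : ∀ φ, φ ∉ Sh → fderiv ℝ χ φ = 0)
    (t : WTerm {x : α // blk x ∈ W} κ ι P) (hD : t.dirs ≠ []) :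
    |∫ φ, ((t.groups.map fun h => (h.pend : Multiset _)).sum.map fun w => φ ⬝ᵥ w).prod
        * (dlist t.dirs χ φ * vexp c legs φ) ∂(fieldLaw blk Δ ℱ W)|
      ≤ Real.sqrt (∫ φ, ((t.groups.map fun h => (h.pend : Multiset _)).sum.map fun w => φ ⬝ᵥ w).prod ^ 2
            ∂(fieldLaw blk Δ ℱ W))
        * (Kd t.dirs * Real.sqrt (∫ φ, Sh.indicator (fun _ => (1 : ℝ)) φ ∂(fieldLaw blk Δ ℱ W))) :=
  abs_integral_fieldLaw_le_shell blk Δ ℱ W hPD c legs hχ hK hSh hχS _ hD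

end Literature.MathematicalPhysics.QuantumFieldTheory.BalabanImbrieJaffe1984to88.BIJ88WalkRemainderFieldLaw312

end
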